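import Literature.AlgebraicGeometry.Frobenioids.EquivalenceFrobeniusQuasiIsotropic
import Literature.AlgebraicGeometry.Frobenioids.FrobeniusTypeIsotropic
import Mathlib.Algebra.Group.Conj
import HarnessLib

/-!
# Frobenioids I, §3: Theorem 3.4 (iv), "`Ψ^{ℕ≥1}` is the identity" — the case of Frobenioids of
# GROUP-LIKE type (via a Frobenius-compact object)

Mochizuki, *The geometry of Frobenioids I: the general theory*, Kyushu J. Math. **62** (2008)
293–400, Thm. 3.4 (iv), statement kurims p. 63 l. 4 ("and `Ψ^{ℕ≥1}` is the identity automorphism"),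
proof kurims p. 66 l. 42 – p. 67 l. 21 (journal p. 350) [cite: MochizukiFrdI2008, Thm. 3.4 (iv) p.66]:

> "Thus, to complete the proof of assertion (iv), it suffices to show that `Ψ^{ℕ≥1}` is the identity
> automorphism. If `C₁`, `C₂` are not of group-like type, then this already follows formally from
> assertion (iii). Thus, let us assume … that `C₁`, `C₂` are of group-like type. Observe that there
> exists an object `A₁ ∈ Ob(C₁)` such that `A₂ := Ψ(A₁)` is Frobenius-compact [cf. Definition 3.1 …].
> By Proposition 1.10, (vi), `A₁`, `A₂` are Frobenius-trivial. Let `φ₁ ∈ End_{C₁}(A₁)` be a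
> base-identity prime-Frobenius endomorphism. By assertion (iii), `φ₂ := Ψ(φ₁)` is also a
> prime-Frobenius morphism. Write `φ₂ = α ∘ ψ₂`, where `ψ₂` is a base-identity prime-Frobenius
> endomorphism of `A₂` and `α ∈ Aut_{C₂}(A₂)` [cf. Definition 1.3, (ii)]. Now since `C₁`, `C₂` are of
> Frobenius-normalized type …, it follows that for every `u₁ ∈ O^×(A₁)`, `u₁^{p₁} ∘ φ₁ = φ₁ ∘ u₁` … Thus,
> for `u₂ ∈ O^×(A₂)`, we obtain `u₂^{p₁} ∘ φ₂ = φ₂ ∘ u₂ = α ∘ ψ₂ ∘ u₂ = α ∘ u₂^{p₂} ∘ ψ₂ =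
> α ∘ u₂^{p₂} ∘ α⁻¹ ∘ φ₂` …, hence [by the total epimorphicity of `C₂`] `u₂^{p₁} = α ∘ u₂^{p₂} ∘ α⁻¹`,
> i.e., `α` acts on `O^×(A₂)^pf` by multiplication by `p₁/p₂`. Since `A₂` is Frobenius-compact, we
> thus conclude that `p₁ = p₂`."

PROOF-ONLY file (abc-iut cell, seat abc-iut-w4-d033; menu row M2 = sub-DAG row `FrdI:Thm3.4(iv)/L09
PsiN_Identity`, GROUP-LIKE HALF, of `plan/L1/SUBDAG-FrdI-Thm34.md`, L1-lead ruling R68 (B); parent DAG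
node `FrdI:Thm3.4(iv)`; the non-group-like half is abc-iut-L1-t13's `FrdI.degFr_map`, p410831). Over
found's Def. 1.2/1.3 API. We run the printed argument with the Frobenius-compact object taken in
`C₁^istr` (Def. 3.1 (i)(b) for `C₁`) and `A₂ := Ψ(A₁)` on the nose, the automorphism `α` pulled back to
`A₁` along the fully faithful `Ψ`, so that Frobenius-compactness is used at `A₁`; the comparison of the
unit normalisations of `A₁` and `A₂` needs exactly the clause "`Ψ` preserves `O^×(−)`" of Thm. 3.4 (iv)
(sub-DAG row L08, NOT proved here) — it enters BY NAME as the hypothesis `hU`; likewise the degree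
formula `deg_Fr(Ψ φ) = Ψ^{ℕ≥1}(deg_Fr φ)` of Thm. 3.4 (iii) (row L01g) enters by name as `hN` in the final
corollary. Prime degrees play no role: the argument gives `deg_Fr(Ψ φ₁) = deg_Fr(φ₁)` for a base-identity
endomorphism of Frobenius type of ANY degree.

* `FrdI.degFr_map_eq_of_frobeniusCompact`: the computation above;
* `FrdI.preservesDegFr_of_groupLike`: hence, given any degree function `N` with
  `deg_Fr(Ψ φ) = N(deg_Fr φ)`, `Ψ` preserves all Frobenius degrees (`Ψ^{ℕ≥1} = id`).

No statement of the paper is restated as a `Prop` or strengthened; the hypotheses "`D_i`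
Frobenius-slim / FSMFF-type", "`Φ_i` non-dilating" of the printed theorem are not used in this step and
not assumed. Nothing here bears on the disputed [IUTchIII] Cor. 3.12.
-/

set_option backward.isDefEq.respectTransparency false

namespace Literature.AlgebraicGeometry.Frobenioids

open CategoryTheory Opposite

universe w v v' u u'

namespace FrdI

/-! ### Bookkeeping: powers in `Aut A` and `End A`, Frobenius-normalisation for units -/

section One

variable {D : Type u} [Category.{v} D] {Φ : Dᵒᵖ ⥤ CommMonCat.{w}} {C : Type u'} [Category.{v'} C]
  {F : C ⥤ ElemFrobenioid Φ}

/-- `(u^n).hom = (u.hom)^n` (Mathlib: `Aut A` multiplies by `x * y = y ≪≫ x`, `End A` by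
`f * g = g ≫ f`). [cite: MochizukiFrdI2008, Def. 1.2 (ii) p.22] -/
theorem aut_pow_hom {A : C} (u : Aut A) (n : ℕ) : (u ^ n).hom = End.asHom (End.of u.hom ^ n) := by
  induction n with
  | zero => rw [pow_zero, pow_zero]; rfl
  | succ n ih =>
    rw [pow_succ, pow_succ, Aut.Aut_mul_def, Iso.trans_hom, ih]
    rfl

/-- A unit `u ∈ O^×(A)` lies in `O^▷(A)` (as an endomorphism). [cite: MochizukiFrdI2008, Def. 1.2 (ii) p.22] -/
theorem hom_mem_endSubmonoid_of_mem_unitsSubgroup {A : C} {u : Aut A}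
    (hu : u ∈ PreFrobenioid.unitsSubgroup F A) : End.of u.hom ∈ PreFrobenioid.endSubmonoid F A :=
  ⟨hu.1, hu.2⟩

/-- Frobenius-normalisation for a unit `u ∈ O^×(A)` and a base-identity endomorphism `φ` of degree `d`:
`φ ≫ u^d = u ≫ φ`. [cite: MochizukiFrdI2008, Def. 1.2 (iv) p.23] -/
theorem comp_pow_eq_of_isFrobeniusNormalized {A : C} (hA : PreFrobenioid.IsFrobeniusNormalized F A)
    {φ : A ⟶ A} (hφ : PreFrobenioid.IsBaseIdentity F φ) {d : ℕ+} (hd : PreFrobenioid.degFr F φ = d)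
    {u : Aut A} (hu : u ∈ PreFrobenioid.unitsSubgroup F A) :
    φ ≫ (u ^ (d : ℕ)).hom = u.hom ≫ φ := by
  have key := hA φ hφ (End.of u.hom) (hom_mem_endSubmonoid_of_mem_unitsSubgroup hu)
  rw [hd] at key
  rw [aut_pow_hom]
  exact key

/-- A base-identity endomorphism is a base-isomorphism. [cite: MochizukiFrdI2008, Def. 1.2 (ii) p.21] -/
theorem isBaseIso_of_isBaseIdentity {A : C} {φ : A ⟶ A} (hφ : PreFrobenioid.IsBaseIdentity F φ) :
    PreFrobenioid.IsBaseIso F φ := by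
  change IsIso (PreFrobenioid.Base F φ)
  rw [hφ]
  infer_instance

/-- In a group: if `u` is non-torsion and `u^a = u^b` then `a = b`. [cite: MochizukiFrdI2008, Def. 1.2 (iv) p.23] -/
theorem eq_of_pow_eq_pow_of_nonTorsion {G : Type*} [Group G] {u : G} (hu : ∀ N : ℕ, 0 < N → u ^ N ≠ 1)
    {a b : ℕ} (h : u ^ a = u ^ b) : a = b := by
  by_contra hne
  rcases Nat.lt_or_gt_of_ne hne with hlt | hgt
  · exact hu (b - a) (Nat.sub_pos_of_lt hlt) (by rw [pow_sub _ hlt.le, ← h, mul_inv_cancel])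
  · exact hu (a - b) (Nat.sub_pos_of_lt hgt) (by rw [pow_sub _ hgt.le, h, mul_inv_cancel])

end One

/-! ### The Frobenius-compact argument -/

section Two

variable {D₁ : Type u} [Category.{v} D₁] {Φ₁ : D₁ᵒᵖ ⥤ CommMonCat.{w}} {C₁ : Type u'}
  [Category.{v'} C₁] {D₂ : Type u} [Category.{v} D₂] {Φ₂ : D₂ᵒᵖ ⥤ CommMonCat.{w}} {C₂ : Type u'}
  [Category.{v'} C₂] {F₁ : C₁ ⥤ ElemFrobenioid Φ₁} {F₂ : C₂ ⥤ ElemFrobenioid Φ₂}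

/-- A group-like isotropic object of a Frobenioid of group-like type is Frobenius-trivial ("By
Proposition 1.10, (vi), `A₁`, `A₂` are Frobenius-trivial": Prop. 1.10 (vi) in `C^istr`, transferred
back along `C^istr ↪ C`). [cite: MochizukiFrdI2008, Thm. 3.4 (iv) p.66] -/
theorem isFrobeniusTrivial_of_isIsotropic_of_groupLike (hF₁ : PreFrobenioid.IsFrobenioid F₁)
    (hg₁ : ∀ A : C₁, PreFrobenioid.IsGroupLikeObj F₁ A) {A : C₁} (hA : PreFrobenioid.IsIsotropic F₁ A) :
    PreFrobenioid.IsFrobeniusTrivial F₁ A :=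
  (PreFrobenioid.isFrobeniusTrivial_istr_iff hF₁ ⟨A, hA⟩).1
    (PreFrobenioid.isFrobeniusTrivial_of_isGroupLikeObj_of_isOfIsotropicType
      (PreFrobenioid.isFrobenioid_istr hF₁) (fun X => PreFrobenioid.isIsotropic_istr X)
      (A := (⟨A, hA⟩ : PreFrobenioid.Istr F₁)) (hg₁ A))

/-- **Thm. 3.4 (iv), group-like case, the Frobenius-compact computation.** Let `C₁`, `C₂` be Frobenioids
of quasi-isotropic and group-like type, `Ψ : C₁ ⥲ C₂` an equivalence carrying base-isomorphisms to
base-isomorphisms (hypothesis (b)) and units to units (`hU`: the clause "`Ψ` preserves `O^×(−)`" of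
Thm. 3.4 (iv)), `A₁` an isotropic Frobenius-compact object of `C₁` with `A₁` and `A₂ := Ψ(A₁)`
Frobenius-normalized. Then `Ψ` preserves the Frobenius degree of every base-identity endomorphism of
Frobenius type of `A₁`. [cite: MochizukiFrdI2008, Thm. 3.4 (iv) p.66] -/
theorem degFr_map_eq_of_frobeniusCompact (hF₂ : PreFrobenioid.IsFrobenioid F₂)
    (hq₁ : (PreFrobenioidData.ofFunctor Φ₁ F₁).IsOfQuasiIsotropicType)
    (hq₂ : (PreFrobenioidData.ofFunctor Φ₂ F₂).IsOfQuasiIsotropicType)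
    (hg₂ : ∀ A : C₂, PreFrobenioid.IsGroupLikeObj F₂ A) (Ψ : C₁ ≌ C₂)
    (hb : ∀ ⦃A B : C₁⦄ (φ : A ⟶ B), PreFrobenioid.IsBaseIso F₁ φ →
      PreFrobenioid.IsBaseIso F₂ (Ψ.functor.map φ))
    (hU : ∀ (A : C₁) (u : Aut A), u ∈ PreFrobenioid.unitsSubgroup F₁ A →
      Ψ.functor.mapIso u ∈ PreFrobenioid.unitsSubgroup F₂ (Ψ.functor.obj A))
    {A₁ : C₁} (hA₁i : PreFrobenioid.IsIsotropic F₁ A₁)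
    (hA₁c : (PreFrobenioidData.ofFunctor Φ₁ F₁).IsFrobeniusCompact A₁)
    (hn₁ : PreFrobenioid.IsFrobeniusNormalized F₁ A₁)
    (hn₂ : PreFrobenioid.IsFrobeniusNormalized F₂ (Ψ.functor.obj A₁))
    {φ₁ : A₁ ⟶ A₁} (hφ₁F : PreFrobenioid.IsFrobeniusType F₁ φ₁) (hφ₁b : PreFrobenioid.IsBaseIdentity F₁ φ₁) :
    PreFrobenioid.degFr F₂ (Ψ.functor.map φ₁) = PreFrobenioid.degFr F₁ φ₁ := by
  have hP₂ := hF₂.isPreFrobenioid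
  obtain ⟨-, ⟨u₀, hu₀, hu₀t⟩, hcpt⟩ := hA₁c
  -- `A₂ := Ψ(A₁)` is isotropic and Frobenius-trivial
  have hA₂i : PreFrobenioid.IsIsotropic F₂ (Ψ.functor.obj A₁) := isIsotropic_map hq₁ hq₂ Ψ hA₁i
  obtain ⟨ζ₂, hζ₂⟩ := isFrobeniusTrivial_of_isIsotropic_of_groupLike hF₂ hg₂ hA₂i
  -- `φ₂ := Ψ(φ₁)` is of Frobenius type; `ψ₂` base-identity of the same degree; `φ₂ = ψ₂ ≫ β`
  set d : ℕ+ := PreFrobenioid.degFr F₁ φ₁ with hd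
  set d₂ : ℕ+ := PreFrobenioid.degFr F₂ (Ψ.functor.map φ₁) with hd₂
  have hφ₂F : PreFrobenioid.IsFrobeniusType F₂ (Ψ.functor.map φ₁) :=
    ⟨⟨PreFrobenioid.isCoAngular_of_isIsotropic_codomains F₂ _ fun X γ => hF₂.vii_b γ hA₂i,
      hg₂ _ _⟩, hb φ₁ hφ₁F.2⟩
  obtain ⟨hψ₂d, hψ₂b, hψ₂F⟩ := hζ₂ d₂
  obtain ⟨β, hβ⟩ := hF₂.ii_unique (ζ₂ d₂) (Ψ.functor.map φ₁) hψ₂F hφ₂F hψ₂d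
  -- pull `β` back to `A₁`
  let f : Aut A₁ := Ψ.functor.preimageIso β
  have hf : Ψ.functor.map f.hom = β.hom := by
    change Ψ.functor.map (Ψ.functor.preimage β.hom) = β.hom
    exact Ψ.functor.map_preimage β.hom
  -- the conjugation action of `f` on `O^×(A₁)`: `(f u f⁻¹)^{d₂} = u^d`
  have key : ∀ u ∈ PreFrobenioid.unitsSubgroup F₁ A₁, (f * u * f⁻¹) ^ (d₂ : ℕ) = u ^ (d : ℕ) := by
    intro u hu
    -- normalisation at `A₁`: `φ₁ ≫ u^d = u ≫ φ₁`
    have h1 : φ₁ ≫ (u ^ (d : ℕ)).hom = u.hom ≫ φ₁ := comp_pow_eq_of_isFrobeniusNormalized hn₁ hφ₁b hd.symm hu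
    -- the unit `v := Ψ u` of `A₂` and normalisation at `A₂`: `ψ₂ ≫ v^{d₂} = v ≫ ψ₂`
    have hv : Ψ.functor.mapAut A₁ u ∈ PreFrobenioid.unitsSubgroup F₂ (Ψ.functor.obj A₁) := hU A₁ u hu
    have h2 : End.asHom (ζ₂ d₂) ≫ ((Ψ.functor.mapAut A₁ u) ^ (d₂ : ℕ)).hom =
        (Ψ.functor.mapAut A₁ u).hom ≫ End.asHom (ζ₂ d₂) :=
      comp_pow_eq_of_isFrobeniusNormalized hn₂ hψ₂b hψ₂d hv
    -- `Ψ` of powers of `u`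
    have hpow : ∀ n : ℕ, Ψ.functor.map ((u ^ n).hom) = ((Ψ.functor.mapAut A₁ u) ^ n).hom := fun n => by
      rw [← map_pow]
      rfl
    have hβ' : End.asHom (ζ₂ d₂) ≫ β.hom = Ψ.functor.map φ₁ := hβ
    -- apply `Ψ` to `h1`, substitute `φ₂ = ψ₂ ≫ β`, cancel the epimorphism `ψ₂`
    have h3 : β.hom ≫ ((Ψ.functor.mapAut A₁ u) ^ (d : ℕ)).hom =
        ((Ψ.functor.mapAut A₁ u) ^ (d₂ : ℕ)).hom ≫ β.hom := by
      have h1' := congrArg Ψ.functor.map h1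
      rw [Functor.map_comp, Functor.map_comp, hpow, ← hβ', Category.assoc] at h1'
      have h2' : Ψ.functor.map u.hom ≫ End.asHom (ζ₂ d₂) =
          End.asHom (ζ₂ d₂) ≫ ((Ψ.functor.mapAut A₁ u) ^ (d₂ : ℕ)).hom := h2.symm
      have h4 : End.asHom (ζ₂ d₂) ≫ β.hom ≫ ((Ψ.functor.mapAut A₁ u) ^ (d : ℕ)).hom =
          End.asHom (ζ₂ d₂) ≫ ((Ψ.functor.mapAut A₁ u) ^ (d₂ : ℕ)).hom ≫ β.hom := by
        rw [h1', ← Category.assoc, h2', Category.assoc]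
      haveI := hP₂.isTotallyEpimorphic.epi (End.asHom (ζ₂ d₂))
      exact (cancel_epi (End.asHom (ζ₂ d₂))).1 h4
    -- back in `C₁` by faithfulness
    have h5 : f.hom ≫ (u ^ (d : ℕ)).hom = (u ^ (d₂ : ℕ)).hom ≫ f.hom := by
      apply Ψ.functor.map_injective
      rw [Functor.map_comp, Functor.map_comp, hf, hpow, hpow, h3]
    rw [conj_pow]
    ext
    change f.inv ≫ (u ^ (d₂ : ℕ)).hom ≫ f.hom = (u ^ (d : ℕ)).hom
    rw [← h5, Iso.inv_hom_id_assoc]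
  -- Frobenius-compactness: `f` then acts trivially on `O^×(A₁)^pf`; compare on the non-torsion unit
  obtain ⟨N, hN, hfix⟩ := hcpt f d d₂ (fun u hu => ⟨1, Nat.one_pos, by rw [pow_one, pow_one, key u hu]⟩) u₀ hu₀
  have h6 : u₀ ^ ((d : ℕ) * N) = u₀ ^ ((d₂ : ℕ) * N) := by
    rw [pow_mul, ← key u₀ hu₀, ← pow_mul, mul_comm, pow_mul, hfix, ← pow_mul, mul_comm]
  have h7 := eq_of_pow_eq_pow_of_nonTorsion hu₀t h6
  exact PNat.eq ((Nat.mul_left_inj hN.ne').1 h7).symm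

/-- **Thm. 3.4 (iv), "`Ψ^{ℕ≥1}` is the identity automorphism" for Frobenioids of GROUP-LIKE type.**
`C₁`, `C₂` Frobenioids of quasi-isotropic (standard type (a)), Frobenius-normalized (standard type (c))
and group-like type, `C₁^istr` admitting a Frobenius-compact object (standard type (b)), `Ψ` an
equivalence satisfying hypothesis (b) and carrying units to units (Thm. 3.4 (iv), clause `O^×`, by
name); if `deg_Fr(Ψ φ) = N(deg_Fr φ)` for some function `N` (Thm. 3.4 (iii): `N = Ψ^{ℕ≥1}`, by name),
then `Ψ` preserves all Frobenius degrees. [cite: MochizukiFrdI2008, Thm. 3.4 (iv) p.63] -/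
theorem preservesDegFr_of_groupLike (hF₁ : PreFrobenioid.IsFrobenioid F₁)
    (hF₂ : PreFrobenioid.IsFrobenioid F₂)
    (hq₁ : (PreFrobenioidData.ofFunctor Φ₁ F₁).IsOfQuasiIsotropicType)
    (hq₂ : (PreFrobenioidData.ofFunctor Φ₂ F₂).IsOfQuasiIsotropicType)
    (hg₁ : ∀ A : C₁, PreFrobenioid.IsGroupLikeObj F₁ A) (hg₂ : ∀ A : C₂, PreFrobenioid.IsGroupLikeObj F₂ A)
    (hn₁ : ∀ A : C₁, PreFrobenioid.IsFrobeniusNormalized F₁ A)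
    (hn₂ : ∀ A : C₂, PreFrobenioid.IsFrobeniusNormalized F₂ A)
    (hc₁ : ∃ A : C₁, PreFrobenioid.IsIsotropic F₁ A ∧ (PreFrobenioidData.ofFunctor Φ₁ F₁).IsFrobeniusCompact A)
    (Ψ : C₁ ≌ C₂)
    (hb : ∀ ⦃A B : C₁⦄ (φ : A ⟶ B), PreFrobenioid.IsBaseIso F₁ φ →
      PreFrobenioid.IsBaseIso F₂ (Ψ.functor.map φ))
    (hU : ∀ (A : C₁) (u : Aut A), u ∈ PreFrobenioid.unitsSubgroup F₁ A →
      Ψ.functor.mapIso u ∈ PreFrobenioid.unitsSubgroup F₂ (Ψ.functor.obj A))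
    {N : ℕ+ → ℕ+} (hN : ∀ ⦃A B : C₁⦄ (φ : A ⟶ B),
      PreFrobenioid.degFr F₂ (Ψ.functor.map φ) = N (PreFrobenioid.degFr F₁ φ)) :
    ∀ ⦃A B : C₁⦄ (φ : A ⟶ B), PreFrobenioid.degFr F₂ (Ψ.functor.map φ) = PreFrobenioid.degFr F₁ φ := by
  obtain ⟨A₁, hA₁i, hA₁c⟩ := hc₁
  obtain ⟨ζ₁, hζ₁⟩ := isFrobeniusTrivial_of_isIsotropic_of_groupLike hF₁ hg₁ hA₁i
  -- `N d = d` for every `d`: test on the base-identity Frobenius endomorphism `ζ₁ d` of `A₁`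
  have hNid : ∀ d : ℕ+, N d = d := by
    intro d
    obtain ⟨hζd, hζb, hζF⟩ := hζ₁ d
    rw [← hζd, ← hN (ζ₁ d)]
    exact degFr_map_eq_of_frobeniusCompact hF₂ hq₁ hq₂ hg₂ Ψ hb hU hA₁i hA₁c (hn₁ A₁) (hn₂ _) hζF hζb
  intro A B φ
  rw [hN φ, hNid]

/-- **Thm. 3.4 (iv), clause "`Ψ^{ℕ≥1}` is the identity", in the vocabulary of the typed statement
`PreFrobenioidData.Thm34iv` (abc-iut-L1-t3), for Frobenioids of GROUP-LIKE type** through the adapter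
`PreFrobenioidData.ofFunctor`: from standard type ((a) quasi-isotropic, (b) a Frobenius-compact object
of `C₁^istr`, (c) Frobenius-normalized), hypothesis (b) `HypB`, the clause "`Ψ` preserves `O^×(−)`" of
Thm. 3.4 (iv) (`hU`, sub-DAG row L08, by name) and the automorphism `Ψ^{ℕ≥1}` of Thm. 3.4 (iii) (`hΨN`,
row L01g, by name): `PreservesDegFr`. [cite: MochizukiFrdI2008, Thm. 3.4 (iv) p.63] -/
theorem preservesDegFr_ofFunctor_of_isOfGroupLikeType (hF₁ : PreFrobenioid.IsFrobenioid F₁)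
    (hF₂ : PreFrobenioid.IsFrobenioid F₂) (Ψ : C₁ ≌ C₂)
    (hs₁ : (PreFrobenioidData.ofFunctor Φ₁ F₁).IsOfStandardType)
    (hs₂ : (PreFrobenioidData.ofFunctor Φ₂ F₂).IsOfStandardType)
    (hB : PreFrobenioidData.HypB (PreFrobenioidData.ofFunctor Φ₁ F₁) (PreFrobenioidData.ofFunctor Φ₂ F₂) Ψ)
    (hg₁ : (PreFrobenioidData.ofFunctor Φ₁ F₁).IsOfGroupLikeType)
    (hg₂ : (PreFrobenioidData.ofFunctor Φ₂ F₂).IsOfGroupLikeType)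
    (hU : ∀ (A : C₁) (α : Aut A), α ∈ (PreFrobenioidData.ofFunctor Φ₁ F₁).unitsSubgroup A →
      Ψ.functor.mapIso α ∈ (PreFrobenioidData.ofFunctor Φ₂ F₂).unitsSubgroup (Ψ.functor.obj A))
    (hΨN : ∃ ΨN : ℕ+ ≃* ℕ+, ∀ ⦃A B : C₁⦄ (φ : A ⟶ B),
      (PreFrobenioidData.ofFunctor Φ₂ F₂).degFr (Ψ.functor.map φ) =
        ΨN ((PreFrobenioidData.ofFunctor Φ₁ F₁).degFr φ)) :
    PreFrobenioidData.PreservesDegFr (PreFrobenioidData.ofFunctor Φ₁ F₁) (PreFrobenioidData.ofFunctor Φ₂ F₂) Ψ := by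
  obtain ⟨ΨN, hN⟩ := hΨN
  obtain ⟨A₁, hA₁i, hA₁c⟩ := hs₁.frobeniusCompact_of_groupLike hg₁
  have hg₁' : ∀ A : C₁, PreFrobenioid.IsGroupLikeObj F₁ A := fun A =>
    (PreFrobenioidData.ofFunctor_isGroupLikeObj F₁ A).1 (hg₁.obj A)
  have hg₂' : ∀ A : C₂, PreFrobenioid.IsGroupLikeObj F₂ A := fun A =>
    (PreFrobenioidData.ofFunctor_isGroupLikeObj F₂ A).1 (hg₂.obj A)
  exact preservesDegFr_of_groupLike hF₁ hF₂ hs₁.quasiIsotropic hs₂.quasiIsotropic hg₁' hg₂'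
    (fun A => hs₁.frobeniusNormalized.obj A) (fun A => hs₂.frobeniusNormalized.obj A)
    ⟨A₁, (PreFrobenioidData.ofFunctor_isIsotropic F₁ A₁).1 hA₁i, hA₁c⟩ Ψ
    (fun A B φ hφ => (hB hg₁ hg₂).1 φ hφ) hU (N := ΨN) hN

end Two

end FrdI

end Literature.AlgebraicGeometry.Frobenioids
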